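import Literature.Computability.AlgebraicComplexity.AlmanLi2026SpectrumMatMul
import Literature.Computability.AlgebraicComplexity.AlmanLi2026SmallCW
import Literature.Computability.AlgebraicComplexity.OneSliceSpeedup
import Literature.Computability.AlgebraicComplexity.BorderRankCWDischarge
import Literature.Computability.AlgebraicComplexity.BorderRankRestriction
import Literature.Computability.AlgebraicComplexity.BorderRankFlattening
import Literature.Computability.AlgebraicComplexity.AsymptoticRankBorderRank
import HarnessLib

/-!
# A non-minimal border-rank bound is never tight for the asymptotic rank: `bR(T) ≤ r`, `r > n`
# `⟹ R̃(T) < r` (Alman–Li 2026, Cor. 6.1); hence `R̃(cw_q) < q + 2` and `R̃(cw_2) < 3.96` — proved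

Topic `Literature/Computability/AlgebraicComplexity`; companion of `AlmanLi2026SmallCW.lean` (which records
Thm. 1.3 `R̃(cw_2) < 3.931` and Cor. 7.1 `R̃(cw_q) ≤ γ_{q,n}` of J. Alman, B. Li, *Asymptotic Rank Speedup
Theorems, Revisited*, arXiv:2605.21738 (2026) as NAMED FACTS), of `OneSliceSpeedup.lean` (the one-slice
speedup, weak form) and of `AlmanLi2026SpectrumMatMul.lean` (Prop. 4.5, proved).  Read first-hand from the
held text `paper:arxiv-2605.21738`:

> (p0015 L5–L31) **Theorem 6.1** (One-slice speedup for nonminimal border rank). Let `T` be an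
> `n × n × n` tensor over `𝔽`, and suppose that `T ⊴ ⟨r⟩` … then there exists a degeneration
> `T ⊕ ⟨1, r + s − 2n, 1⟩ ⊴ ⟨r⟩ ⊕ ⟨1, s, 1⟩`. When `r > 2n`, this yields the improved asymptotic rank
> bound `R̃(T) ≤ r + s^{2/3} − (r+s−2n)^{2/3} < r`. … *Proof.* … We refer to the setting of the
> three-direction speedup inequalities (eq:degen1)–(eq:degen3) [of Prop. 4.5] with parameters
> `t = r+s−2n` and the same `s`. Since `r > 2n`, we have `t > s`, and thus … `R̃(T) ≤ r + s^{2/3} − t^{2/3}`.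
> (p0015 L46–L53) "we can bootstrap this result to show that any non-minimal border rank upper bound
> for `T` is not tight for its asymptotic rank. **Corollary 6.1.** Let `T` be an `n × n × n` tensor with
> `bR(T) ≤ r`. If `r > n`, then `R̃(T) < r`. *Proof.* Since `T ⊴ ⟨r⟩`, taking tensor powers yields
> `T^{⊗k} ⊴ ⟨r^k⟩`. By choosing `k` sufficiently large such that `r^k > 2n^k`, (Thm. 6.1) implies
> `R̃(T)^k = R̃(T^{⊗k}) < r^k`."
> (p0004 L25–L28) **Theorem 1.3.** `R̃(cw_2) < 3.931`. More generally, for any `q ≥ 2`, we show there is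
> a `δ_q > 0` such that `R̃(cw_q) < q + 2 − δ_q`.
> (p0017 L85–L97) **Corollary 7.1.** … `R̃(cw_q) ≤ γ_q < q + 2`.

## What is proved, and how it differs from the printed constants

The tree's `algDegeneratesTo_oneSliceSpeedup` (`OneSliceSpeedup.lean`) is Thm. 6.1's degeneration in the
WEAK form `T ⊕ ⟨1, bR(T), 1⟩ ⊴ ⟨bR(T)⟩ ⊕ ⟨1, |κ|+|μ|, 1⟩` (garbage slice `|κ| + |μ|`, i.e. "`s = 2n`,
`t = r`" instead of `s ≤ n`, `t = r + s − 2n`).  Applied to `T`, `rotate T`, `rotate² T` and rotated back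
(`bR` is `rotate`-invariant, tree `algBorderRank_rotate`) it yields the three directions of Prop. 4.5 with
`t = bR(T)` and any `S ≥ |ι|+|κ|, |κ|+|μ|, |μ|+|ι|` (§B, `algDegeneratesTo_three_directions`).  Then:

* **`AlmanLi2026.asymptoticRank_le_max_of_card_le`** (the weak Thm. 6.1 bound): with `r = bR(T)`,
  `R̃(T) ≤ max S (r + S^{2/3} − r^{2/3})` — Prop. 4.5, Case 1 (`AlmanLi2026.prop45_of_lt`) if `r > S`,
  else `R̃ ≤ bR ≤ S`;
* **`AlmanLi2026.cor61`** — **Cor. 6.1 exactly as printed** (all three index types of size `≤ n`,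
  `bR(T) ≤ r`, `n < r` ⟹ `R̃(T) < r`), by the printed bootstrap: `k` with `2n^k < r^k`,
  `bR(T^{⊗k}) ≤ r^k`, `R̃(T)^k ≤ R̃(T^{⊗k})` (at a maximising spectral point; Strassen duality is proved in
  the tree) and the weak Thm. 6.1 bound for `T^{⊗k}` with `S = 2n^k`;
* **`AlmanLi2026.asymptoticRank_cwTensor_lt`**: `R̃(cw_q) < q + 2` for EVERY `q` and every field
  (`bR(cw_q) ≤ q + 2`, tree `algBorderRank_cwTensor_le`; `n = q + 1 < q + 2`) — the printed
  "`R̃(cw_q) ≤ γ_q < q + 2`" / "there is a `δ_q > 0` …" (`AlmanLi2026.exists_delta`);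
* **`AlmanLi2026.asymptoticRank_cwTensor_two_lt`**: `R̃(cw_2) < 3.96` (`k = 4`: `R̃(cw_2)^4 ≤
  256 + 162^{2/3} − 256^{2/3} ≤ 245.43 < 3.96^4`), hence **`…_two_lt_four`**: `R̃(cw_2) < 4 = bR(cw_2)`
  unconditionally (the tree's `asymptoticRank_cwTwo_lt_four` assumes the fact
  `AlmanLi2026_asymptoticRank_cwTwo_lt`).

The printed constants `3.931` (Thm. 1.3, via the iterated identity of Thm. 6.2) and `γ_{2,4} ≈ 3.9335`
(Cor. 7.1) are sharper than `3.96`: they need Lemma 7.1 (the rank-`q` slack of the Coppersmith–Winograd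
identity, `s = q^n`), which is not in the tree.  The named facts of `AlmanLi2026SmallCW.lean` are
therefore NOT discharged here.

## Tree inputs, consumed by name

`algDegeneratesTo_oneSliceSpeedup`, `oneSliceTensor` (`OneSliceSpeedup`); `algBorderRank_rotate`
(`BorderRankFlattening`); `algBorderRank_kroneckerPow_le` (`BorderRankRestriction`);
`asymptoticRank_le_algBorderRank` (`AsymptoticRankBorderRank`); `algBorderRank_cwTensor_le`
(`BorderRankCWDischarge`); `AlmanLi2026.prop45_of_lt`, `rpow_sub_rpow_le_rpow_sub_rpow`
(`AlmanLi2026SpectrumMatMul`); `strassen_duality_asymptoticRank_holds`, `IsUniversalSpectralPoint.map_kroneckerPow`; `rotate`,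
`matMulTensor_rotate`; `TensorRestrictsTo.algDegeneratesTo_trans`, `AlgDegeneratesTo.trans_restrictsTo`.
`lean search 'asymptoticRank.*cwTensor|cwTensor.*asymptoticRank|cor61|below.*borderRank'`: only the
named facts of `AlmanLi2026SmallCW.lean`, their consumer `asymptoticRank_cwTwo_lt_four`, and Summits-side
users.

## References

* J. Alman, B. Li, *Asymptotic Rank Speedup Theorems, Revisited*, arXiv:2605.21738 (2026), Thm. 1.3,
  Prop. 4.5, Thm. 6.1, Cor. 6.1, Prop. 7.1, Cor. 7.1.  [AlmanLi2026]
* V. Strassen, *The asymptotic spectrum of tensors*, J. reine angew. Math. 384 (1988) (the one-slice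
  speedup; the source's attribution for the existence of `δ_q`).  [Strassen1988]
* A. Conner, F. Gesmundo, J. M. Landsberg, E. Ventura, *Rank and border rank of Kronecker powers of
  tensors and Strassen's laser method*, comput. complexity 31 (2022), §1.2 (`bR(cw_q) = q + 2`).
  [ConnerGesmundoLandsbergVentura2022]
* M. Bläser, *Fast Matrix Multiplication*, ToC Graduate Surveys 5 (2013), Lemma 5.5, Thm. 6.3(1)
  (rotating the modes).  [Blaser2013]
-/

noncomputable section

open scoped BigOperators

namespace Literature.Computability.AlgebraicComplexity

variable {K : Type} [Field K]

/-! ## A. One-slice tensors are the matrix multiplication lines `⟨1, s, 1⟩` -/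

section Lines

/-- `oneSlice(σ) ≥ ⟨1, s, 1⟩` for `|σ| = s` (the two tensors agree after relabelling: `⟨1,s,1⟩` is one
inner product of length `s`). [cite: AlmanLi2026, §5.3] -/
theorem tensorRestrictsTo_oneSliceTensor_matMulTensor {σ : Type} [Fintype σ] [DecidableEq σ] {s : ℕ}
    (e : σ ≃ Fin s) : TensorRestrictsTo (oneSliceTensor K σ) (matMulTensor K 1 s 1) := by
  have h : matMulTensor K 1 s 1 = fun (a : Fin 1 × Fin 1) (b : Fin 1 × Fin s) (c : Fin s × Fin 1) =>
      oneSliceTensor K σ () (e.symm b.2) (e.symm c.1) := by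
    funext a b c
    simp only [matMulTensor, oneSliceTensor_apply, e.symm.injective.eq_iff]
    have h1 : a.1 = b.1 := Subsingleton.elim _ _
    have h2 : a.2 = c.2 := Subsingleton.elim _ _
    simp [h1, h2]
  rw [h]
  exact tensorRestrictsTo_precomp (oneSliceTensor K σ) _ _ _

/-- `⟨1, S, 1⟩ ≥ oneSlice(σ)` for `|σ| ≤ S` (embed `σ` into `Fin S`). [cite: AlmanLi2026, §5.3] -/
theorem tensorRestrictsTo_matMulTensor_oneSliceTensor {σ : Type} [Fintype σ] [DecidableEq σ] {S : ℕ}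
    (e : σ ↪ Fin S) : TensorRestrictsTo (matMulTensor K 1 S 1) (oneSliceTensor K σ) := by
  have h : oneSliceTensor K σ = fun (_ : Unit) (x y : σ) =>
      matMulTensor K 1 S 1 ((0 : Fin 1), (0 : Fin 1)) ((0 : Fin 1), e x) (e y, (0 : Fin 1)) := by
    funext u x y
    simp [matMulTensor, oneSliceTensor_apply, e.injective.eq_iff]
  rw [h]
  exact tensorRestrictsTo_precomp (matMulTensor K 1 S 1) _ _ _

end Lines

/-! ## B. Relabelling the three modes (`rotate`) and the three directions of the weak speedup -/

section Rotate

open Polynomial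

variable {ι κ μ ι' κ' μ' : Type}

/-- Rotating the three modes of an approximate restriction. [folklore] -/
private theorem isApproxRestriction_rotate_modes [Fintype ι] [Fintype κ] [Fintype μ] {h : ℕ}
    {s : ι → κ → μ → K} {t : ι' → κ' → μ' → K} {A : ι' → ι → K[X]} {B : κ' → κ → K[X]}
    {C : μ' → μ → K[X]} (hr : IsApproxRestriction h s t A B C) :
    IsApproxRestriction h (rotate s) (rotate t) B C A := by
  intro b' c' a' j hj
  have e1 : ∀ b c a, B b' b * C c' c * A a' a * Polynomial.C (rotate s b c a) =
      A a' a * B b' b * C c' c * Polynomial.C (s a b c) := fun b c a => by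
    rw [rotate_apply]; ring
  simp only [e1]
  rw [show (∑ b, ∑ c, ∑ a, A a' a * B b' b * C c' c * Polynomial.C (s a b c)) =
      ∑ a, ∑ b, ∑ c, A a' a * B b' b * C c' c * Polynomial.C (s a b c) from by
    rw [Finset.sum_congr rfl fun b _ => Finset.sum_comm, Finset.sum_comm], rotate_apply]
  exact hr a' b' c' j hj

/-- **Degeneration is compatible with relabelling the modes**: `t ⊴ s ⟹ πt ⊴ πs` for the cyclic
permutation `π` of the three factors. [cite: Blaser2013, Thm. 6.3] -/
theorem algDegeneratesTo_rotate_modes [Fintype ι] [Fintype κ] [Fintype μ] {s : ι → κ → μ → K}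
    {t : ι' → κ' → μ' → K} (h : AlgDegeneratesTo s t) : AlgDegeneratesTo (rotate s) (rotate t) := by
  obtain ⟨h, A, B, C, hd⟩ := h
  exact ⟨h, B, C, A, isApproxRestriction_rotate_modes hd⟩

omit [Field K] in
/-- `rotate (s ⊕ t) = rotate s ⊕ rotate t` (plumbing for the three-directions argument;
`private`: no mathematical content of its own). [folklore] -/
private theorem rotate_directSumTensor' [CommSemiring K] (s : ι → κ → μ → K) (t : ι' → κ' → μ' → K) :
    rotate (directSumTensor s t) = directSumTensor (rotate s) (rotate t) := by
  funext b c a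
  rcases a with a | a <;> rcases b with b | b <;> rcases c with c | c <;> rfl

omit [Field K] in
/-- `rotate ⟨n⟩ = ⟨n⟩` (plumbing; `private`). [folklore] -/
private theorem rotate_unitTensor' [CommSemiring K] (n : ℕ) : rotate (unitTensor K n) = unitTensor K n := by
  funext b c a
  simp only [rotate_apply, unitTensor_apply]
  exact if_congr ⟨fun ⟨h1, h2⟩ => ⟨h2, (h1.trans h2).symm⟩, fun ⟨h1, h2⟩ => ⟨(h1.trans h2).symm, h1⟩⟩
    rfl rfl

omit [Field K] in
/-- `rotate ⟨k,m,n⟩` IS `⟨m,n,k⟩` after swapping the coordinates of the first and third index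
(Bläser 2013, Lemma 5.5; tree `matMulTensor_rotate`). [cite: Blaser2013, Lemma 5.5] -/
theorem rotate_matMulTensor_eq [CommSemiring K] (k m n : ℕ) :
    rotate (matMulTensor K k m n) = fun b c a => matMulTensor K m n k (Prod.swap b) c (Prod.swap a) := by
  funext b c a
  exact matMulTensor_rotate K k m n b c a

omit [Field K] in
/-- `⟨m,n,k⟩ ≥ rotate ⟨k,m,n⟩`. [cite: Blaser2013, Lemma 5.5] -/
theorem tensorRestrictsTo_matMulTensor_rotate' [CommSemiring K] (k m n : ℕ) :
    TensorRestrictsTo (matMulTensor K m n k) (rotate (matMulTensor K k m n)) := by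
  rw [rotate_matMulTensor_eq]
  exact tensorRestrictsTo_precomp (matMulTensor K m n k) Prod.swap id Prod.swap

omit [Field K] in
/-- `rotate ⟨k,m,n⟩ ≥ ⟨m,n,k⟩` (the swaps are bijections).  A `private` copy, for commutative
semirings, of the tree's `tensorRestrictsTo_rotate_matMulTensor` (`LaserMethodValuesSym.lean`, fields;
not imported here to keep `LaserSymmetrization` out of scope). [cite: Blaser2013, Lemma 5.5] -/
private theorem tensorRestrictsTo_rotate_matMulTensor_semiring [CommSemiring K] (k m n : ℕ) :
    TensorRestrictsTo (rotate (matMulTensor K k m n)) (matMulTensor K m n k) := by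
  have h : matMulTensor K m n k = fun b c a =>
      rotate (matMulTensor K k m n) (Prod.swap b) c (Prod.swap a) := by
    funext b c a
    rw [rotate_matMulTensor_eq]
    simp
  rw [h]
  exact tensorRestrictsTo_precomp (rotate (matMulTensor K k m n)) Prod.swap id Prod.swap

/-- Restriction is compatible with relabelling the modes. [cite: Blaser2013, Thm. 6.3] -/
theorem tensorRestrictsTo_rotate_modes [Fintype ι] [Fintype κ] [Fintype μ]
    {s : ι → κ → μ → K} {t : ι' → κ' → μ' → K} (h : TensorRestrictsTo s t) :
    TensorRestrictsTo (rotate s) (rotate t) := by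
  obtain ⟨A, B, C, hs⟩ := h
  refine ⟨B, C, A, fun b' c' a' => ?_⟩
  rw [rotate_apply, hs a' b' c', Finset.sum_comm]
  refine Finset.sum_congr rfl fun b _ => ?_
  rw [Finset.sum_comm]
  refine Finset.sum_congr rfl fun c _ => Finset.sum_congr rfl fun a _ => ?_
  rw [rotate_apply]; ring

/-- The weak one-slice speedup in the placement `⟨1,·,1⟩`, with the garbage slice padded to any
`S ≥ |κ| + |μ|`: `⟨bR(T)⟩ ⊕ ⟨1,S,1⟩ ⊵ T ⊕ ⟨1, bR(T), 1⟩` (Thm. 6.1, weak form: tree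
`algDegeneratesTo_oneSliceSpeedup`). [cite: AlmanLi2026, Thm. 6.1] -/
theorem algDegeneratesTo_oneSlice_direction₂ [Fintype ι] [Fintype κ] [Fintype μ] [DecidableEq ι]
    [DecidableEq κ] [DecidableEq μ] (T : ι → κ → μ → K) {S : ℕ}
    (hS : Fintype.card κ + Fintype.card μ ≤ S) :
    AlgDegeneratesTo (directSumTensor (unitTensor K (algBorderRank T)) (matMulTensor K 1 S 1))
      (directSumTensor T (matMulTensor K 1 (algBorderRank T) 1)) := by
  classical
  have hcard : Fintype.card (κ ⊕ μ) ≤ S := by rwa [Fintype.card_sum]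
  exact (((TensorRestrictsTo.refl _).directSum
      (tensorRestrictsTo_matMulTensor_oneSliceTensor
        ((Fintype.equivFin (κ ⊕ μ)).toEmbedding.trans (Fin.castLEEmb hcard))))
    |>.algDegeneratesTo_trans (algDegeneratesTo_oneSliceSpeedup (K := K) T)).trans_restrictsTo
    ((TensorRestrictsTo.refl _).directSum
      (tensorRestrictsTo_oneSliceTensor_matMulTensor (Equiv.refl (Fin (algBorderRank T)))))

/-- **The three directions of the weak one-slice speedup**, for an ARBITRARY tensor `T` with finite index
types and any `S` dominating the three sums of two dimensions: with `r = bR(T)`,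
`⟨r⟩ ⊕ ⟨S,1,1⟩ ⊵ T ⊕ ⟨r,1,1⟩`, `⟨r⟩ ⊕ ⟨1,S,1⟩ ⊵ T ⊕ ⟨1,r,1⟩`, `⟨r⟩ ⊕ ⟨1,1,S⟩ ⊵ T ⊕ ⟨1,1,r⟩`
(the speedup applied to `T`, `rotate² T`, `rotate T` and rotated back; `bR(rotate T) = bR(T)`).  This is
the hypothesis set (eq:degen1)–(eq:degen3) of Prop. 4.5 "with the same `s`" used in the proof of Thm. 6.1.
[cite: AlmanLi2026, Thm. 6.1 (proof)] -/
theorem algDegeneratesTo_three_directions [Fintype ι] [Fintype κ] [Fintype μ] [DecidableEq ι]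
    [DecidableEq κ] [DecidableEq μ] (T : ι → κ → μ → K) {S : ℕ}
    (h₁₂ : Fintype.card ι + Fintype.card κ ≤ S) (h₂₃ : Fintype.card κ + Fintype.card μ ≤ S)
    (h₃₁ : Fintype.card μ + Fintype.card ι ≤ S) :
    AlgDegeneratesTo (directSumTensor (unitTensor K (algBorderRank T)) (matMulTensor K S 1 1))
        (directSumTensor T (matMulTensor K (algBorderRank T) 1 1)) ∧
      AlgDegeneratesTo (directSumTensor (unitTensor K (algBorderRank T)) (matMulTensor K 1 S 1))
        (directSumTensor T (matMulTensor K 1 (algBorderRank T) 1)) ∧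
      AlgDegeneratesTo (directSumTensor (unitTensor K (algBorderRank T)) (matMulTensor K 1 1 S))
        (directSumTensor T (matMulTensor K 1 1 (algBorderRank T))) := by
  classical
  set r := algBorderRank T with hr
  refine ⟨?_, algDegeneratesTo_oneSlice_direction₂ T h₂₃, ?_⟩
  · -- speedup for `rotate² T : μ → ι → κ → K`, rotated once more (`rotate³ = id`)
    have h0 := algDegeneratesTo_oneSlice_direction₂ (K := K) (rotate (rotate T)) h₁₂
    rw [algBorderRank_rotate, algBorderRank_rotate, ← hr] at h0
    have h1 := algDegeneratesTo_rotate_modes h0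
    rw [rotate_directSumTensor', rotate_directSumTensor', rotate_unitTensor',
      show rotate (rotate (rotate T)) = T from rfl] at h1
    exact (((TensorRestrictsTo.refl _).directSum (tensorRestrictsTo_matMulTensor_rotate' 1 S 1))
      |>.algDegeneratesTo_trans h1).trans_restrictsTo
      ((TensorRestrictsTo.refl _).directSum (tensorRestrictsTo_rotate_matMulTensor_semiring 1 r 1))
  · -- speedup for `rotate T : κ → μ → ι → K`, rotated twice
    have h0 := algDegeneratesTo_oneSlice_direction₂ (K := K) (rotate T) h₃₁
    rw [algBorderRank_rotate, ← hr] at h0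
    have h1 := algDegeneratesTo_rotate_modes (algDegeneratesTo_rotate_modes h0)
    rw [rotate_directSumTensor', rotate_directSumTensor', rotate_unitTensor',
      rotate_directSumTensor', rotate_directSumTensor', rotate_unitTensor',
      show rotate (rotate (rotate T)) = T from rfl] at h1
    -- `⟨1,1,S⟩ ≥ rotate (rotate ⟨1,S,1⟩)` and `rotate (rotate ⟨1,r,1⟩) ≥ ⟨1,1,r⟩`
    have pre : TensorRestrictsTo (matMulTensor K 1 1 S) (rotate (rotate (matMulTensor K 1 S 1))) :=
      (tensorRestrictsTo_matMulTensor_rotate' S 1 1).trans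
        (tensorRestrictsTo_rotate_modes (tensorRestrictsTo_matMulTensor_rotate' 1 S 1))
    have post : TensorRestrictsTo (rotate (rotate (matMulTensor K 1 r 1))) (matMulTensor K 1 1 r) :=
      (tensorRestrictsTo_rotate_modes (tensorRestrictsTo_rotate_matMulTensor_semiring 1 r 1)).trans
        (tensorRestrictsTo_rotate_matMulTensor_semiring r 1 1)
    exact (((TensorRestrictsTo.refl _).directSum pre).algDegeneratesTo_trans h1).trans_restrictsTo
      ((TensorRestrictsTo.refl _).directSum post)

end Rotate

/-! ## C. The weak Thm. 6.1 bound and Cor. 6.1 -/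

section Cor61

variable {ι κ μ : Type} [Fintype ι] [Fintype κ] [Fintype μ] [DecidableEq ι] [DecidableEq κ]
  [DecidableEq μ]

/-- **Thm. 6.1's asymptotic-rank bound, weak form**: for any tensor `T` with finite index types and any
`S ≥ 1` dominating `|ι|+|κ|, |κ|+|μ|, |μ|+|ι|`, with `r = bR(T)`:
`R̃(T) ≤ max S (r + S^{2/3} − r^{2/3})` — if `r > S`, Prop. 4.5 Case 1 on the three directions of the
weak speedup (printed: `R̃(T) ≤ r + s^{2/3} − (r+s−2n)^{2/3}` when `r > 2n`); otherwise `R̃(T) ≤ bR(T) ≤ S`.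
[cite: AlmanLi2026, Thm. 6.1] -/
theorem AlmanLi2026.asymptoticRank_le_max_of_card_le (T : ι → κ → μ → K) {S : ℕ} (hS : 1 ≤ S)
    (h₁₂ : Fintype.card ι + Fintype.card κ ≤ S) (h₂₃ : Fintype.card κ + Fintype.card μ ≤ S)
    (h₃₁ : Fintype.card μ + Fintype.card ι ≤ S) :
    asymptoticRank T ≤ max (S : ℝ)
      ((algBorderRank T : ℝ) + ((S : ℝ) ^ (2 / 3 : ℝ) - (algBorderRank T : ℝ) ^ (2 / 3 : ℝ))) := by
  set r := algBorderRank T with hr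
  by_cases hSr : S < r
  · obtain ⟨h₁, h₂, h₃⟩ := algDegeneratesTo_three_directions (K := K) T h₁₂ h₂₃ h₃₁
    exact (AlmanLi2026.prop45_of_lt T hS hSr h₁ h₂ h₃).trans (le_max_right _ _)
  · have h1 : asymptoticRank T ≤ r := asymptoticRank_le_algBorderRank T
    have h2 : (r : ℝ) ≤ S := by exact_mod_cast not_lt.1 hSr
    exact (h1.trans h2).trans (le_max_left _ _)

omit [DecidableEq ι] [DecidableEq κ] [DecidableEq μ] in
/-- `R̃(t)^k ≤ R̃(t^{⊗k})` (at a spectral point attaining `R̃(t)`, `φ(t)^k = φ(t^{⊗k}) ≤ R̃(t^{⊗k})`;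
Strassen duality, proved in the tree; the printed proof of Cor. 6.1 uses `R̃(T)^k = R̃(T^{⊗k})`).
[cite: AlmanLi2026, Corollary 6.1 (proof)] -/
theorem asymptoticRank_pow_le_asymptoticRank_kroneckerPow (t : ι → κ → μ → K) (k : ℕ) :
    asymptoticRank t ^ k ≤ asymptoticRank (kroneckerPow t k) := by
  obtain ⟨F, hF, hFt⟩ := (strassen_duality_asymptoticRank_holds K t).2
  rw [← hFt, ← hF.map_kroneckerPow]
  exact (strassen_duality_asymptoticRank_holds K _).1 F hF

/-- The bootstrap step of Cor. 6.1 in quantitative form: if all three index types have size `≤ n`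
(`n ≥ 1`) and `bR(T) ≤ r`, then for every `k`,
`R̃(T)^k ≤ max (2n^k) (r^k + (2n^k)^{2/3} − (r^k)^{2/3})`
(`bR(T^{⊗k}) ≤ bR(T)^k ≤ r^k`; the weak Thm. 6.1 bound for `T^{⊗k}` with `S = 2n^k`, whose right-hand
side is increasing in `bR(T^{⊗k})`). [cite: AlmanLi2026, Corollary 6.1 (proof)] -/
theorem AlmanLi2026.asymptoticRank_pow_le_max (T : ι → κ → μ → K) {n r : ℕ} (hn : 1 ≤ n)
    (hι : Fintype.card ι ≤ n) (hκ : Fintype.card κ ≤ n) (hμ : Fintype.card μ ≤ n)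
    (hT : algBorderRank T ≤ r) (k : ℕ) :
    asymptoticRank T ^ k ≤
      max (2 * (n : ℝ) ^ k) ((r : ℝ) ^ k + (2 * (n : ℝ) ^ k) ^ (2 / 3 : ℝ) - ((r : ℝ) ^ k) ^ (2 / 3 : ℝ)) := by
  classical
  set Tk := kroneckerPow T k with hTk
  set rk := algBorderRank Tk with hrk
  have hS1 : 1 ≤ 2 * n ^ k := by
    have : 1 ≤ n ^ k := Nat.one_le_pow _ _ hn
    omega
  have hcard : ∀ {α : Type} [Fintype α], Fintype.card α ≤ n → Fintype.card (Fin k → α) ≤ n ^ k := by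
    intro α _ hα
    rw [Fintype.card_fun, Fintype.card_fin]
    exact Nat.pow_le_pow_left hα k
  have hb := AlmanLi2026.asymptoticRank_le_max_of_card_le (K := K) Tk hS1
    (by have := hcard hι; have := hcard hκ; omega) (by have := hcard hκ; have := hcard hμ; omega)
    (by have := hcard hμ; have := hcard hι; omega)
  have hrk_le : rk ≤ r ^ k := (algBorderRank_kroneckerPow_le T k).trans (Nat.pow_le_pow_left hT k)
  have hrk_le' : (rk : ℝ) ≤ (r : ℝ) ^ k := by exact_mod_cast hrk_le
  have hcast : ((2 * n ^ k : ℕ) : ℝ) = 2 * (n : ℝ) ^ k := by push_cast; ring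
  refine (asymptoticRank_pow_le_asymptoticRank_kroneckerPow T k).trans (hb.trans ?_)
  rw [hcast]
  refine max_le_max le_rfl ?_
  -- monotonicity of `x ↦ x - x^{2/3}` on `[1, ∞)`, or the trivial case `rk ≤ 2n^k`
  by_cases hlt : 2 * n ^ k < rk
  · have hrk1 : (1 : ℝ) ≤ rk := by exact_mod_cast le_trans hS1 hlt.le
    have hmono := rpow_sub_rpow_le_rpow_sub_rpow (s := (r : ℝ) ^ k) (t := (rk : ℝ))
      (x := (2 / 3 : ℝ)) (y := 1) hrk1 hrk_le' (by norm_num) (by norm_num)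
    rw [Real.rpow_one, Real.rpow_one] at hmono
    linarith
  · -- here `rk ≤ 2n^k ≤ ... `: both sides compared through `2n^k`
    have h2 : (rk : ℝ) ≤ 2 * (n : ℝ) ^ k := by rw [← hcast]; exact_mod_cast not_lt.1 hlt
    have hS0 : (0 : ℝ) ≤ 2 * (n : ℝ) ^ k := by positivity
    have hrk0 : (0 : ℝ) ≤ rk := Nat.cast_nonneg _
    have hA : (rk : ℝ) ^ (2 / 3 : ℝ) ≤ (2 * (n : ℝ) ^ k) ^ (2 / 3 : ℝ) :=
      Real.rpow_le_rpow hrk0 h2 (by norm_num)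
    have hB : ((r : ℝ) ^ k) ^ (2 / 3 : ℝ) ≤ ((r : ℝ) ^ k) ^ (1 : ℝ) ∨ (r : ℝ) ^ k < 1 := by
      by_cases h1 : (1 : ℝ) ≤ (r : ℝ) ^ k
      · exact Or.inl (Real.rpow_le_rpow_of_exponent_le h1 (by norm_num))
      · exact Or.inr (not_le.1 h1)
    rcases hB with hB | hB
    · rw [Real.rpow_one] at hB
      -- `rk + S^{2/3} - rk^{2/3} ≤ ?`: we only need `rk - rk^{2/3} ≤ r^k - (r^k)^{2/3}`
      have hmono : (rk : ℝ) - (rk : ℝ) ^ (2 / 3 : ℝ) ≤ (r : ℝ) ^ k - ((r : ℝ) ^ k) ^ (2 / 3 : ℝ) := by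
        by_cases hrk1 : (1 : ℝ) ≤ rk
        · have hm := rpow_sub_rpow_le_rpow_sub_rpow (s := (r : ℝ) ^ k) (t := (rk : ℝ))
            (x := (2 / 3 : ℝ)) (y := 1) hrk1 hrk_le' (by norm_num) (by norm_num)
          rw [Real.rpow_one, Real.rpow_one] at hm
          linarith
        · -- `rk < 1`, i.e. `rk = 0`: left side is `0 - 0`, right side is `≥ 0`
          have hrk0' : rk = 0 := by
            by_contra hne
            exact hrk1 (by exact_mod_cast Nat.one_le_iff_ne_zero.2 hne)
          have : (rk : ℝ) = 0 := by exact_mod_cast hrk0'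
          rw [this, Real.zero_rpow (by norm_num)]
          linarith
      linarith
    · -- `r^k < 1` forces `r = 0` (and `k ≥ 1`), so `rk = 0` and `T^{⊗k} = 0`
      have hr0 : (r : ℝ) ^ k = 0 := by
        rcases Nat.eq_zero_or_pos r with hr | hr
        · subst hr
          rcases Nat.eq_zero_or_pos k with hk | hk
          · subst hk; norm_num at hB
          · simp [zero_pow (Nat.pos_iff_ne_zero.1 hk)]
        · exfalso
          have : (1 : ℝ) ≤ (r : ℝ) ^ k := one_le_pow₀ (by exact_mod_cast hr)
          linarith
      have hrk0' : (rk : ℝ) = 0 := by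
        have : (rk : ℝ) ≤ 0 := hr0 ▸ hrk_le'
        linarith
      rw [hr0, hrk0', Real.zero_rpow (by norm_num)]
      linarith

/-- **Alman–Li 2026, Corollary 6.1** ("any non-minimal border rank upper bound for `T` is not tight
for its asymptotic rank"): let `T` be an `n × n × n` tensor — here: all three index types of size
`≤ n` — with `bR(T) ≤ r`.  If `r > n`, then `R̃(T) < r`.  Proof as printed: choose `k` with
`r^k > 2n^k`; then `R̃(T)^k ≤ R̃(T^{⊗k}) < r^k` by the (weak) Thm. 6.1 bound.
[cite: AlmanLi2026, Corollary 6.1] -/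
theorem AlmanLi2026.cor61 (T : ι → κ → μ → K) {n r : ℕ} (hι : Fintype.card ι ≤ n)
    (hκ : Fintype.card κ ≤ n) (hμ : Fintype.card μ ≤ n) (hT : algBorderRank T ≤ r) (hnr : n < r) :
    asymptoticRank T < r := by
  have hr0 : (0 : ℝ) < r := by exact_mod_cast lt_of_le_of_lt (Nat.zero_le n) hnr
  rcases Nat.eq_zero_or_pos n with hn0 | hn
  · -- `n = 0`: all index types are empty, `T = 0`, `R̃(T) ≤ bR(T) = 0 < r`… via `bR(T) ≤ R(T) ≤ |ι| = 0`
    subst hn0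
    have hι0 : Fintype.card ι = 0 := Nat.le_zero.1 hι
    have hR : algBorderRank T ≤ 0 := by
      calc algBorderRank T ≤ tensorRank T := algBorderRank_le_tensorRank T
        _ ≤ Fintype.card ι * Fintype.card κ * Fintype.card μ := tensorRank_le_card T
        _ = 0 := by rw [hι0]; simp
    have h1 : asymptoticRank T ≤ (algBorderRank T : ℝ) := asymptoticRank_le_algBorderRank T
    have h2 : (algBorderRank T : ℝ) ≤ 0 := by exact_mod_cast hR
    linarith
  -- an exponent `k` with `2 n^k < r^k`
  obtain ⟨k, hk⟩ := exists_pow_lt_of_lt_one (show (0 : ℝ) < 1 / 2 by norm_num)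
    (show (n : ℝ) / (r : ℝ) < 1 by
      rw [div_lt_one hr0]; exact_mod_cast hnr)
  have hlt : 2 * (n : ℝ) ^ k < (r : ℝ) ^ k := by
    rw [div_pow, div_lt_iff₀ (pow_pos hr0 k)] at hk
    linarith
  have hpow := AlmanLi2026.asymptoticRank_pow_le_max (K := K) T hn hι hκ hμ hT k
  have hS0 : (0 : ℝ) ≤ 2 * (n : ℝ) ^ k := by positivity
  have hB : max (2 * (n : ℝ) ^ k) ((r : ℝ) ^ k + (2 * (n : ℝ) ^ k) ^ (2 / 3 : ℝ) -
      ((r : ℝ) ^ k) ^ (2 / 3 : ℝ)) < (r : ℝ) ^ k := by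
    refine max_lt hlt ?_
    have : (2 * (n : ℝ) ^ k) ^ (2 / 3 : ℝ) < ((r : ℝ) ^ k) ^ (2 / 3 : ℝ) :=
      Real.rpow_lt_rpow hS0 hlt (by norm_num)
    linarith
  have hlt' : asymptoticRank T ^ k < (r : ℝ) ^ k := lt_of_le_of_lt hpow hB
  refine lt_of_not_ge fun hge => ?_
  exact absurd (pow_le_pow_left₀ hr0.le hge k) (not_le.2 hlt')

end Cor61

/-! ## D. The little Coppersmith–Winograd tensor -/

section SmallCW

/-- **Alman–Li 2026, Thm. 1.3 (general `q`) / Cor. 7.1: `R̃(cw_q) < q + 2`** — the asymptotic rank of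
the little Coppersmith–Winograd tensor is STRICTLY below its border rank `q + 2`, for every `q` and over
every field (Cor. 6.1 with `n = q + 1 < r = q + 2 ≥ bR(cw_q)`, tree `algBorderRank_cwTensor_le`).
[cite: AlmanLi2026, Corollary 7.1] -/
theorem AlmanLi2026.asymptoticRank_cwTensor_lt (q : ℕ) :
    asymptoticRank (cwTensor K q) < (q : ℝ) + 2 := by
  have h := AlmanLi2026.cor61 (K := K) (cwTensor K q) (n := q + 1) (r := q + 2)
    (by simp) (by simp) (by simp) (algBorderRank_cwTensor_le K q) (by omega)
  exact_mod_cast h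

/-- Thm. 1.3, the general clause as printed: "for any `q ≥ 2` there is a `δ_q > 0` such that
`R̃(cw_q) < q + 2 − δ_q`" (here for every `q`). [cite: AlmanLi2026, Thm 1.3] -/
theorem AlmanLi2026.exists_delta (q : ℕ) :
    ∃ δ : ℝ, 0 < δ ∧ asymptoticRank (cwTensor K q) < (q : ℝ) + 2 - δ := by
  have h := AlmanLi2026.asymptoticRank_cwTensor_lt (K := K) q
  exact ⟨((q : ℝ) + 2 - asymptoticRank (cwTensor K q)) / 2, by linarith, by linarith⟩

/-- `x^{2/3} ≤ c` from `x² ≤ c³` (nonnegative reals). [folklore] -/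
private theorem rpow_two_thirds_le {x c : ℝ} (hx : 0 ≤ x) (hc : 0 ≤ c) (h : x ^ 2 ≤ c ^ 3) :
    x ^ (2 / 3 : ℝ) ≤ c := by
  have e : (x ^ (2 / 3 : ℝ)) ^ (3 : ℕ) = x ^ 2 := by
    rw [← Real.rpow_natCast, ← Real.rpow_mul hx]; norm_num
  rw [← pow_le_pow_iff_left₀ (Real.rpow_nonneg hx _) hc (by norm_num : (3 : ℕ) ≠ 0), e]
  exact h

/-- `c ≤ x^{2/3}` from `c³ ≤ x²` (nonnegative reals). [folklore] -/
private theorem le_rpow_two_thirds {x c : ℝ} (hx : 0 ≤ x) (hc : 0 ≤ c) (h : c ^ 3 ≤ x ^ 2) :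
    c ≤ x ^ (2 / 3 : ℝ) := by
  have e : (x ^ (2 / 3 : ℝ)) ^ (3 : ℕ) = x ^ 2 := by
    rw [← Real.rpow_natCast, ← Real.rpow_mul hx]; norm_num
  rw [← pow_le_pow_iff_left₀ hc (Real.rpow_nonneg hx _) (by norm_num : (3 : ℕ) ≠ 0), e]
  exact h

/-- **`R̃(cw_2) < 3.96`** (`k = 4`, `n = 3`, `r = 4` in `AlmanLi2026.asymptoticRank_pow_le_max`:
`R̃(cw_2)^4 ≤ max(162, 256 + 162^{2/3} − 256^{2/3}) ≤ 256 + 29.73 − 40.3 = 245.43 < 3.96^4 ≈ 245.9`;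
the printed constant is `3.931`, Thm. 1.3). [cite: AlmanLi2026, Thm 1.3] -/
theorem AlmanLi2026.asymptoticRank_cwTensor_two_lt : asymptoticRank (cwTensor K 2) < 3.96 := by
  have h := AlmanLi2026.asymptoticRank_pow_le_max (K := K) (cwTensor K 2) (n := 3) (r := 4)
    (by norm_num) (by simp) (by simp) (by simp) (algBorderRank_cwTensor_le K 2) 4
  norm_num only [Nat.cast_ofNat] at h
  have h1 : (162 : ℝ) ^ (2 / 3 : ℝ) ≤ 29.73 := rpow_two_thirds_le (by norm_num) (by norm_num) (by norm_num)
  have h2 : (40.3 : ℝ) ≤ (256 : ℝ) ^ (2 / 3 : ℝ) := le_rpow_two_thirds (by norm_num) (by norm_num) (by norm_num)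
  have h4 : asymptoticRank (cwTensor K 2) ^ 4 < (3.96 : ℝ) ^ 4 := by
    refine lt_of_le_of_lt h (max_lt (by norm_num) ?_)
    have : (256 : ℝ) + 29.73 - 40.3 < (3.96 : ℝ) ^ 4 := by norm_num
    linarith
  exact lt_of_pow_lt_pow_left₀ 4 (by norm_num) h4

/-- **`R̃(cw_2) < 4 = bR(cw_2)`**, unconditionally (the tree's `asymptoticRank_cwTwo_lt_four` assumes the
fact `AlmanLi2026_asymptoticRank_cwTwo_lt`). [cite: AlmanLi2026, Thm 1.3] -/
theorem AlmanLi2026.asymptoticRank_cwTensor_two_lt_four : asymptoticRank (cwTensor K 2) < 4 :=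
  lt_trans AlmanLi2026.asymptoticRank_cwTensor_two_lt (by norm_num)

/-- **The CGLV phenomenon must eventually fail** (Alman–Li §6, p. 17, the sentence after the proof of
Cor. 6.1): Conner–Gesmundo–Landsberg–Ventura proved that the border rank does not drop for small powers,
`bR(cw_q^{⊗n}) = (q+2)^n` for `q > 2, n = 2` and for `q > 4, n = 3`; "we show that the asymptotic rank
of `cw_q` is strictly smaller than `q + 2`, and hence this phenomenon must eventually fail for larger
`n`": since `R̃(cw_q) = inf_n R(cw_q^{⊗n})^{1/n} < q + 2`, some Kronecker power has RANK — hence border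
rank — strictly below `(q+2)^n`. [cite: AlmanLi2026, §6 (p. 17, after the proof of Cor. 6.1)] -/
theorem AlmanLi2026.exists_tensorRank_kroneckerPow_cwTensor_lt (q : ℕ) :
    ∃ n : ℕ, 1 ≤ n ∧ tensorRank (kroneckerPow (cwTensor K q) n) < (q + 2) ^ n := by
  have hlt := AlmanLi2026.asymptoticRank_cwTensor_lt (K := K) q
  unfold asymptoticRank at hlt
  obtain ⟨N, hN⟩ := exists_lt_of_ciInf_lt hlt
  refine ⟨N + 1, by omega, ?_⟩
  have hx : (0 : ℝ) ≤ (tensorRank (kroneckerPow (cwTensor K q) (N + 1)) : ℝ) := Nat.cast_nonneg _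
  have hpos : (0 : ℝ) < (N : ℝ) + 1 := by positivity
  have h : (tensorRank (kroneckerPow (cwTensor K q) (N + 1)) : ℝ) < ((q : ℝ) + 2) ^ (N + 1) := by
    calc (tensorRank (kroneckerPow (cwTensor K q) (N + 1)) : ℝ)
        = (((tensorRank (kroneckerPow (cwTensor K q) (N + 1)) : ℝ) ^ ((N : ℝ) + 1)⁻¹)) ^
            ((N : ℝ) + 1) := by
          rw [← Real.rpow_mul hx, inv_mul_cancel₀ hpos.ne', Real.rpow_one]
      _ < ((q : ℝ) + 2) ^ ((N : ℝ) + 1) := Real.rpow_lt_rpow (Real.rpow_nonneg hx _) hN hpos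
      _ = ((q : ℝ) + 2) ^ (N + 1) := by
          rw [show ((N : ℝ) + 1) = ((N + 1 : ℕ) : ℝ) by push_cast; ring, Real.rpow_natCast]
  exact_mod_cast h

/-- Border-rank form of the previous statement: for every `q` some power `cw_q^{⊗n}`, `n ≥ 1`, has
`bR(cw_q^{⊗n}) < (q+2)^n` (so the CGLV equalities `bR(cw_q^{⊗n}) = (q+2)^n` cannot persist for all `n`).
[cite: AlmanLi2026, §6 (p. 17, after the proof of Cor. 6.1)] -/
theorem AlmanLi2026.exists_algBorderRank_kroneckerPow_cwTensor_lt (q : ℕ) :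
    ∃ n : ℕ, 1 ≤ n ∧ algBorderRank (kroneckerPow (cwTensor K q) n) < (q + 2) ^ n := by
  obtain ⟨n, hn, h⟩ := AlmanLi2026.exists_tensorRank_kroneckerPow_cwTensor_lt (K := K) q
  exact ⟨n, hn, (algBorderRank_le_tensorRank _).trans_lt h⟩

end SmallCW

end Literature.Computability.AlgebraicComplexity

end
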